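/-
COR-CM DICTIONARY ARROW A3 (cell pub-hodgecm2; lead/typer planner-pub-hodgecm2-lead-0 and -lead-g2-0, 2026-08-20).  KERNEL wiring
only: from the model universe's `U.HC_CM` to `HC_CM` through the tree's Milne-1999 edge, GUARDED domination form (v2).
Nothing is asserted.
-/
import Summits.HodgeConjecture.CorCM.Interfaces
import Literature.AlgebraicGeometry.Milne1999.TateFromCodesHCOfHSimplePos
import HarnessLib

/-!
# COR-CM — arrow A3 of `HOME/CHAIN-MAP.md` (the dictionary, KERNEL in the tree), GUARDED DOMINATION FORM (v2)

`(Model.picardCMUniverse hHD hI h₁ h₃).HC_CM` — the conclusion of the package chain A1 + A2 (= [QW8] Thm 0.3 (i)) on the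
model — is by `Iff.rfl` the tree's `Milne1999.CodesHC hHD (ballQuotientUniformisedDatum_of h₁) h₃`
(`Interfaces.picardCMUniverse_hc_cm_iff_codesHC`).  The tree edge
`Milne1999.forall_cmHodgeHypothesisAt_of_codesHC_pos (hC) (hDomPos)` (`Milne1999/TateFromCodesHCOfHSimplePos.lean`) turns it
into `∀ A, CMHodgeHypothesisAt A = HC_CM` given
* `hDomPos` — GUARDED DOMINATION: every complex abelian variety of CM type and POSITIVE dimension is isogenous to (an abelian
  variety whose scheme is) the interpretation of a CM-flagged code of the model (Shimura–Taniyama structure theorem; binder row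
  B03 of `HOME/BINDER-OWNERS.md`).  Dimension `0` is settled inside the edge (`hodgeConjectureFor_of_dim_le_three_holds`).
  The tree derives `hDomPos` from Riemann's theorem `DeligneMilne1982_Thm_6_20_full` = the displayed binder `hR`
  (`Milne1999/TateFromCodesHCOfRiemann.lean`: `thm2_cor_of_riemann`, `hSimplePos_of_riemann`; `TateFromCodesHCOfHSimplePos.lean`:
  `hDecompPos_of_hSimplePos`, `hDomPos_of_hDecompPos`), so B03 is discharged from B02 by a one-line junction once those compose
  in the tree (seat b11, `Milne1999.hDomPos_of_riemann`).

v1 of this file used the UNGUARDED binder `hDom` of `Milne1999.forall_cmHodgeHypothesisAt_of_codesHC`; that proposition is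
FALSE as stated (the trivial abelian variety has dimension `0`, is of CM type, and every CM-flagged code has positive
dimension — seat b11's `Milne1999.not_hDom`, the degeneracy the tree records for `hSimple` in `TateFromCodesHCOfHSimplePos.lean`),
so a binder of that type could never be discharged.  v2 is the repair; the working target `HC_CM_of_PerLFace` and
`Interfaces.lean` are unchanged.
-/

noncomputable section

namespace Summit.HodgeConjecture.CorCM

open Literature.NumberTheory.Automorphic.PicardCM
open Literature.AlgebraicGeometry.HodgeTheory
open Literature.AlgebraicGeometry.Motives
open Literature.AlgebraicGeometry.Milne1999

/-- **Guarded domination of CM abelian varieties by the model's CM codes** (binder B03, the `hDomPos` input of the tree edge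
`Milne1999.forall_cmHodgeHypothesisAt_of_codesHC_pos`, VERBATIM its binder type): every complex abelian variety of CM type
(Milne 1999 §2 shape `IsOfCMType`) of positive dimension is isogenous to an abelian variety whose underlying scheme is the
interpretation `PicardCM.Var.scheme hU h₃ v` of a CM-flagged code `v`.  A consequence of Riemann's theorem (tree:
`Milne1999/TateFromCodesHCOfRiemann.lean` + `TateFromCodesHCOfHSimplePos.lean`); recorded as a named proposition so that binder
rows can cite it. [folklore] -/
def CMDominatedByCodesPos (hU : BallQuotientUniformisedDatum) (h₃ : CMAbelianVarietyRealised) : Prop :=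
  ∀ A : AbelianVariety ℂ, 0 < A.dim → IsOfCMType A →
    ∃ (v : Var) (B : AbelianVariety ℂ), Var.IsCMAbelianVariety h₃ v ∧
      B.X = Var.scheme hU h₃ v ∧ AbelianVariety.IsIsogenous A B

/-- **A3 (guarded domination form).** `U.HC_CM` for the model universe implies `HC_CM`, given guarded domination (B03). -/
theorem hc_cm_of_model_hc_cm (hHD : exists_isReal_hodgeModel) (hI : hodgePQ_independent_of_hodgeModel)
    (h₁ : BallQuotientUniformised) (h₃ : CMAbelianVarietyRealised)
    (hDom : CMDominatedByCodesPos (ballQuotientUniformisedDatum_of h₁) h₃)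
    (h : (Model.picardCMUniverse hHD hI h₁ h₃).HC_CM) : HC_CM :=
  hc_cm_iff_forall_cmHodgeHypothesisAt.2
    (forall_cmHodgeHypothesisAt_of_codesHC_pos ((picardCMUniverse_hc_cm_iff_codesHC hHD hI h₁ h₃).1 h) hDom)

/-- **The E term's shape, reduced to the model chain**: a proof of the package chain A0 → A1 → A2 ON THE MODEL
(`U.PerLFace → U.HC_CM` for `U := Model.picardCMUniverse …`, i.e. the port of `Universe.hc_cm_of ∘ Universe.w_rk4_of`
with the model's `ModelAxioms` rows) plus guarded domination from Riemann's theorem (B03, derived from B02) gives the working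
target `HC_CM_of_PerLFace`. -/
theorem hc_cm_of_PerLFace_of_modelChain
    (dom : ∀ (h₁ : BallQuotientUniformised) (h₃ : CMAbelianVarietyRealised),
      DeligneMilne1982_Thm_6_20_full → CMDominatedByCodesPos (ballQuotientUniformisedDatum_of h₁) h₃)
    (chain : ∀ (hHD : exists_isReal_hodgeModel) (hI : hodgePQ_independent_of_hodgeModel)
      (h₁ : BallQuotientUniformised) (h₃ : CMAbelianVarietyRealised),
      (Model.picardCMUniverse hHD hI h₁ h₃).PerLFace → (Model.picardCMUniverse hHD hI h₁ h₃).HC_CM) :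
    HC_CM_of_PerLFace :=
  fun hHD hI h₁ h₃ hP hR => hc_cm_of_model_hc_cm hHD hI h₁ h₃ (dom h₁ h₃ hR) (chain hHD hI h₁ h₃ hP)

end Summit.HodgeConjecture.CorCM

end
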